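import Literature.AlgebraicGeometry.Resolution.ProperModelsPatching
import Literature.AlgebraicGeometry.Resolution.ProperModelsPatchingGluing
import Literature.AlgebraicGeometry.Resolution.ProperModelsRegLeification
import Literature.AlgebraicGeometry.Resolution.ProperModelsModification
import Literature.AlgebraicGeometry.Resolution.ProjectiveModelsCharts
import Literature.AlgebraicGeometry.Resolution.GraphClosureCompactification
import Literature.AlgebraicGeometry.Resolution.PrincipalizationToResolution
import Literature.AlgebraicGeometry.Resolution.ResolutionGlue
import Literature.AlgebraicGeometry.Resolution.QuasiProjectiveResolution
import Literature.AlgebraicGeometry.Resolution.CanonicalResolutionProofs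
import Literature.AlgebraicGeometry.Resolution.AlterationsResolution
import Literature.AlgebraicGeometry.Morphisms.NagataCompactification
import HarnessLib

/-!
# Weak resolution of sandwiched-singularity varieties is two-model patching (modulo Nagata)

Topic: `Literature/AlgebraicGeometry/Resolution`. The gen-1 lead of crux `PatchingRel`
(stmt-ResolutionOfSingularities-0642, line `sandwiched-gluing`) reshapes the line's atom from the
STRONG resolution of sandwiched schemes (`SandwichedStrongResolution`, `ProperModelsPatching.lean`)
to a WEAK statement: an integral variety whose singular locus is contained in an open `V` which
is proper and birational over a REGULAR variety has a (weak) resolution. This file records that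
statement as the `Prop`-valued definition `SandwichedWeakResolution p` and PROVES its position
(it turns out to be EQUIVALENT to two-model patching of proper models, modulo Nagata):

* `sandwichedWeakResolution_of_resolutionInChar` — `ResolutionInChar p → SandwichedWeakResolution p`
  (a sandwiched variety is a variety).
* `ProperModel.ofChart` — a proper integral `k`-scheme with an affine chart `Spec A`,
  `Frac A = K`, as a proper model of `K/k` (proper twin of `ProjModel.ofChart`);
  `exists_integral_compactification` — Nagata + closure: every integral separated finite-type
  `k`-scheme is open in an integral proper one.
* `sandwichedWeakResolution_of_twoModelPatching` — **`NagataCompactification →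
  ProperModel.TwoModelPatching p → SandwichedWeakResolution p`**: two-model patching of proper
  models (Zariski 1944; Piltant 2013, Prop. 5.1 with `P = P_reg`) resolves every
  sandwiched-singularity variety, WITHOUT local uniformization (patch a compactification of `X`
  with a compactification of the regular base `U`; the patch is regular over `X ∖ V ⊆ Reg X` and
  over `V`, whose points go to `U` under the second projection).
* `ProperModel.regLeification_of_twoModelPatching`, `ProperModel.localRegLeification_of_regLeification`,
  `ProperModel.localRegLeification_iff_twoModelPatching` — modulo Nagata the three upper
  statements of `ProperModelsPatching.lean` coincide:
  `LocalRegLeification p ↔ TwoModelPatching p (↔ RegLeification p)`.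
* `ProperModel.localRegLeification_of_sandwichedWeakResolution` — the reshaped line's stub S3′:
  `SandwichedWeakResolution p → LocalRegLeification p` (apply the weak atom to the open
  `Reg M ∪ φ⁻¹(Reg Y)` of `M`; no gluing).
* `sandwichedWeakResolution_iff_twoModelPatching` — hence, modulo Nagata ALONE, the weak atom is
  EQUIVALENT to Piltant's two-model patching problem;
  `sandwichedWeakResolution_of_sandwichedStrongResolution` — and the old atom implies the new
  one (through the landed gluing `SandwichedGluing.localRegLeification_of_openGluing_of_sandwiched`).

## References

* O. Zariski, *Reduction of the singularities of algebraic three dimensional varieties*,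
  Ann. of Math. 45 (1944) 472–542, Fundamental Theorem p. 539.
* O. Piltant, *An axiomatic version of Zariski's patching theorem*, RACSAM 107 (2013) 91–121,
  Prop. 5.1 (two-model patching, `P = P_reg`), p. 2 (open in dimension `≥ 4`). [Piltant2013]
* B. Conrad, *Deligne's notes on Nagata compactifications*, J. Ramanujan Math. Soc. 22 (2007),
  Thm. 4.1. [Conrad2007]
* O. Zariski, P. Samuel, *Commutative Algebra* II, Ch. VI §17 (models of a function field).
  [ZariskiSamuel1960]
-/

noncomputable section

open CategoryTheory AlgebraicGeometry TopologicalSpace IsLocalRing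
open Literature.AlgebraicGeometry.Morphisms

namespace Literature.AlgebraicGeometry.Resolution

universe u

/-- **SANDʷ(p) — weak resolution of varieties with SANDWICHED singular locus in characteristic
`p`**: for a field `k` of characteristic `p`, an integral separated `k`-scheme of finite type
`X`, an open `V ⊆ X` outside which `X` is regular, a REGULAR integral separated `k`-scheme of
finite type `U` and a proper birational `k`-morphism `η : V → U`, the scheme `X` admits a (weak)
resolution of singularities. A `Prop`-valued definition (the transcription, with every
hypothesis spelled out, of the weak atom of crux `PatchingRel`'s line `sandwiched-gluing`); this
file proves that it is implied by `ResolutionInChar p`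
(`sandwichedWeakResolution_of_resolutionInChar`) and EQUIVALENT, modulo Nagata compactification,
to two-model patching of proper models `ProperModel.TwoModelPatching p`
(`sandwichedWeakResolution_iff_twoModelPatching`); in dimension `≤ 3` it is a case of
Cossart–Piltant 2019, Thm. 1.1 (weak form).
[cite: CossartPiltant2019, Thm. 1.1 (the case dim ≤ 3, weak form)] -/
def SandwichedWeakResolution (p : ℕ) : Prop :=
  ∀ (k : Type u) [Field k] [CharP k p] (X U : Scheme.{u}) (f : X ⟶ Spec (.of k))
    (g : U ⟶ Spec (.of k)) (V : X.Opens) (η : (V : Scheme.{u}) ⟶ U),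
    IsSeparated f → LocallyOfFiniteType f → QuasiCompact f → IsIntegral X →
    IsSeparated g → LocallyOfFiniteType g → QuasiCompact g → IsIntegral U →
    Scheme.IsRegular U → IsProper η → IsBirational η → η ≫ g = V.ι ≫ f →
    (∀ x : X, x ∉ V → IsRegularLocalRing (X.presheaf.stalk x)) →
      Scheme.HasResolution X

/-- **`ResolutionInChar p → SandwichedWeakResolution p`** (a sandwiched-singularity variety is a
variety). [folklore] -/
theorem sandwichedWeakResolution_of_resolutionInChar {p : ℕ} (h : ResolutionInChar.{u} p) :
    SandwichedWeakResolution.{u} p := by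
  intro k _ _ X U f g V η hfs hfl hfq hX _ _ _ _ _ _ _ _ _
  exact h k X f hfs hfl hfq inferInstance

/-! ## Proper models from a chart; integral compactifications -/

section Costume

variable {k : Type u} [Field k] {K : Type u} [Field K] [Algebra k K]

/-- **A proper integral `k`-scheme with an affine chart `Spec A ↪ X`, `Frac A = K`, is a proper
model of `K/k`** (the proper twin of `ProjModel.ofChart`, same proof; Zariski–Samuel II, Ch. VI
§17: complete models and their affine representatives). An `abbrev`, so that `(ofChart X …).X`
is reducibly `X`. [cite: ZariskiSamuel1960, Ch. VI §17] -/
abbrev ProperModel.ofChart (X : Scheme.{u}) [IsIntegral X] (πX : X ⟶ Spec (.of k)) [IsProper πX]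
    (A : Type u) [CommRing A] [IsDomain A] [Algebra k A] [Algebra A K] [IsScalarTower k A K]
    [IsFractionRing A K] (j : Spec (.of A) ⟶ X) [IsOpenImmersion j]
    (hj : j ≫ πX = Spec.map (CommRingCat.ofHom (algebraMap k A))) : ProperModel k K where
  X := X
  π := πX
  gen := Spec.map (CommRingCat.ofHom (algebraMap A K)) ≫ j
  gen_π := by
    rw [Category.assoc, hj, ← Spec.map_comp, ← CommRingCat.ofHom_comp,
      ← IsScalarTower.algebraMap_eq]
  isIntegral := ‹_›
  isProper := ‹_›
  genericPt_eq := by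
    rw [Scheme.Hom.comp_apply, specMap_closedPoint_eq_genericPoint A K
      (IsFractionRing.injective A K)]
    exact genericPoint_eq_of_isOpenImmersion j
  isIso_stalkClosedPointTo := by
    rw [Scheme.stalkClosedPointTo_comp]
    have h : ∀ x, IsIso (j.stalkMap x) := fun x => inferInstance
    exact IsIso.comp_isIso' (h _) (isIso_stalkClosedPointTo_of_isFractionRing A K)

/-- **An integral separated finite-type `k`-scheme is an open subscheme of an integral PROPER
`k`-scheme** (Nagata compactification followed by the scheme-theoretic closure,
`exists_graphClosure_compactification`). [cite: Conrad2007, Thm. 4.1 (use)] -/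
theorem exists_integral_compactification (hN : NagataCompactification.{u}) (X : Scheme.{u})
    [IsIntegral X] (f : X ⟶ Spec (.of k)) [IsSeparated f] [LocallyOfFiniteType f]
    [QuasiCompact f] :
    ∃ (Xb : Scheme.{u}) (s : X ⟶ Xb) (π : Xb ⟶ Spec (.of k)), IsIntegral Xb ∧
      IsOpenImmersion s ∧ IsProper π ∧ s ≫ π = f := by
  obtain ⟨Xc, jc, fc, hjc, hfc, hfac⟩ := hN X (Spec (.of k)) f
  haveI := hjc
  haveI := hfc
  haveI : IsLocallyNoetherian X := LocallyOfFiniteType.isLocallyNoetherian f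
  haveI : CompactSpace X := QuasiCompact.compactSpace_of_compactSpace f
  haveI : IsNoetherian X := {}
  obtain ⟨Xb, c, s, hXb, hc, hsc, hs, -, -⟩ :=
    exists_graphClosure_compactification jc (𝟙 Xc) jc (Category.comp_id jc)
  haveI : IsProper (c ≫ 𝟙 Xc) := inferInstance
  haveI := hXb
  haveI := hc
  haveI := hs
  refine ⟨Xb, s, c ≫ fc, hXb, hs, inferInstance, ?_⟩
  rw [← Category.assoc, hsc, hfac]

set_option maxHeartbeats 1600000 in
/-- **Two-model patching of proper models and Nagata compactification imply weak resolution of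
sandwiched-singularity varieties** (`SandwichedWeakResolution p`), with NO local uniformization:
compactify `X` and `U` to proper models `P_X ⊇ X`, `P_U ⊇ U` of the common function field `K`
(common affine chart `Spec A` inside the iso-locus of `η`, `K = Frac A`; `ProperModel.ofChart`,
`exists_integral_compactification`), patch them (Piltant 2013, Prop. 5.1 shape:
`N → P_X`, `N → P_U` both `RegLe`), and restrict `N → P_X` over `X`. A point of `N` over
`X ∖ V ⊆ Reg X` is regular by `RegLe` of the first projection; a point over `V` is mapped into
`U ⊆ Reg P_U` by the second projection — the two morphisms `N|_V → P_U` (second projection; first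
projection followed by `η`) agree on the dominant `K`-point, hence everywhere (reduced source,
separated target, `ext_of_isDominant_of_isSeparated`) — so it is regular by `RegLe` of the second.
[cite: Piltant2013, Prop. 5.1 (shape of two-model patching; this consequence is folklore)] -/
theorem sandwichedWeakResolution_of_twoModelPatching {p : ℕ} (hN : NagataCompactification.{u})
    (hT : ProperModel.TwoModelPatching.{u} p) : SandwichedWeakResolution.{u} p := by
  intro k _ _ X U f g V η hfs hfl hfq hX hgs hgl hgq hU hUreg hηp hbir hcomm hreg
  haveI := hfs; haveI := hfl; haveI := hfq; haveI := hX
  haveI := hgs; haveI := hgl; haveI := hgq; haveI := hU; haveI := hηp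
  classical
  by_cases hV : (V : Set X).Nonempty
  swap
  · -- `V = ∅`: `X` is regular, hence its own resolution
    exact Scheme.IsRegular.hasResolution fun x => hreg x fun hx => hV ⟨x, hx⟩
  /- Step 1: an affine chart `Spec A` of `U` inside the iso-locus `Oη` of `η`. -/
  obtain ⟨Oη, hOηd, -, hOηiso⟩ := hbir
  haveI := hOηiso
  obtain ⟨x₀, hx₀⟩ := hV
  haveI : Nonempty U := ⟨η ⟨x₀, hx₀⟩⟩
  obtain ⟨u₀, hu₀⟩ := hOηd.nonempty
  obtain ⟨_, ⟨W', hW, rfl⟩, hu₀W, hWO⟩ :=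
    U.isBasis_affineOpens.exists_subset_of_mem_open hu₀ Oη.isOpen
  let W : U.Opens := W'
  haveI : IsAffine W := hW
  haveI : Nonempty W := ⟨⟨u₀, hu₀W⟩⟩
  have hWO' : W ≤ Oη := hWO
  let A : Type u := Γ(W, ⊤)
  let gW : (W : Scheme.{u}) ⟶ Spec (.of k) := W.ι ≫ g
  let ψ : k →+* A := gW.appTop.hom.comp (Scheme.ΓSpecIso (.of k)).inv.hom
  have hψ : ψ.FiniteType := by
    have h1 : gW.appTop.hom.FiniteType :=
      (HasRingHomProperty.iff_of_isAffine (P := @LocallyOfFiniteType)).mp inferInstance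
    exact h1.comp (RingHom.FiniteType.of_surjective _
      (Scheme.ΓSpecIso (.of k)).symm.commRingCatIsoToRingEquiv.surjective)
  letI : Algebra k A := ψ.toAlgebra
  haveI hft : Algebra.FiniteType k A := hψ
  let K : Type u := FractionRing A
  haveI : Algebra.EssFiniteType k K := inferInstance
  -- the chart of `U` (an opaque name `jU` for `Spec A ≅ W ⊆ U`)
  obtain ⟨jU, hjUdef⟩ : ∃ jU : Spec (.of A) ⟶ U, jU = W.toScheme.isoSpec.inv ≫ W.ι := ⟨_, rfl⟩
  haveI : IsOpenImmersion jU := by rw [hjUdef]; infer_instance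
  have hjU : jU ≫ g = Spec.map (CommRingCat.ofHom (algebraMap k A)) := by
    rw [hjUdef, Category.assoc, isoSpec_inv_comp]
    rfl
  -- the chart of `X`: `Spec A ≅ W ≅ η⁻¹ W ⊆ V ⊆ X`
  haveI hηW : IsIso (η ∣_ W) := isIso_morphismRestrict_of_le η hOηiso hWO'
  let jV : Spec (.of A) ⟶ (V : Scheme.{u}) :=
    W.toScheme.isoSpec.inv ≫ inv (η ∣_ W) ≫ (η ⁻¹ᵁ W).ι
  have hjVη : jV ≫ η = jU := by
    rw [hjUdef]
    change (W.toScheme.isoSpec.inv ≫ inv (η ∣_ W) ≫ (η ⁻¹ᵁ W).ι) ≫ η =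
      W.toScheme.isoSpec.inv ≫ W.ι
    rw [Category.assoc, Category.assoc, ← morphismRestrict_ι, IsIso.inv_hom_id_assoc]
  obtain ⟨jX, hjXdef⟩ : ∃ jX : Spec (.of A) ⟶ X, jX = jV ≫ V.ι := ⟨_, rfl⟩
  haveI : IsOpenImmersion jX := by rw [hjXdef]; infer_instance
  have hjX : jX ≫ f = Spec.map (CommRingCat.ofHom (algebraMap k A)) := by
    rw [hjXdef, Category.assoc, ← hcomm, ← Category.assoc, hjVη, hjU]
  /- Step 2: integral proper compactifications and the two proper models of `K`. -/
  obtain ⟨Ub, sU, πU, hUb, hsU, hπU, hsUπ⟩ := exists_integral_compactification hN U g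
  obtain ⟨Xb, sX, πX, hXb, hsX, hπX, hsXπ⟩ := exists_integral_compactification hN X f
  haveI := hUb; haveI := hsU; haveI := hπU; haveI := hXb; haveI := hsX; haveI := hπX
  have hcU : (jU ≫ sU) ≫ πU = Spec.map (CommRingCat.ofHom (algebraMap k A)) := by
    rw [Category.assoc, hsUπ, hjU]
  have hcX : (jX ≫ sX) ≫ πX = Spec.map (CommRingCat.ofHom (algebraMap k A)) := by
    rw [Category.assoc, hsXπ, hjX]
  /- Step 3: patch. -/
  obtain ⟨N, φ₁, φ₂, h₁, h₂⟩ :=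
    hT k K (ProperModel.ofChart Xb πX A (jX ≫ sX) hcX) (ProperModel.ofChart Ub πU A (jU ≫ sU) hcU)
  -- abbreviations (term-mode use only)
  let PX : ProperModel k K := ProperModel.ofChart Xb πX A (jX ≫ sX) hcX
  let PU : ProperModel k K := ProperModel.ofChart Ub πU A (jU ≫ sU) hcU
  /- Step 4: the second projection maps `N|_V` into `U`. -/
  have hφ₁gen : φ₁.f (genericPoint N.X) = genericPoint Xb := by
    rw [← N.genericPt_eq']
    change (N.gen ≫ φ₁.f) (closedPoint K) = genericPoint Xb
    rw [φ₁.gen_f]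
    exact PX.genericPt_eq
  have hOne : ((sX ''ᵁ V : Xb.Opens) : Set Xb).Nonempty := ⟨sX x₀, ⟨x₀, hx₀, rfl⟩⟩
  have hWn : ((φ₁.f ⁻¹ᵁ (sX ''ᵁ V) : N.X.Opens) : Set N.X).Nonempty := by
    refine ⟨genericPoint N.X, ?_⟩
    change φ₁.f (genericPoint N.X) ∈ (sX ''ᵁ V : Xb.Opens)
    rw [hφ₁gen]
    exact PX.genericPoint_mem hOne
  haveI : Nonempty ((φ₁.f ⁻¹ᵁ (sX ''ᵁ V) : N.X.Opens) : Scheme.{u}) := ⟨⟨_, hWn.some_mem⟩⟩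
  haveI : IsIntegral ((φ₁.f ⁻¹ᵁ (sX ''ᵁ V) : N.X.Opens) : Scheme.{u}) :=
    isIntegral_of_isOpenImmersion (φ₁.f ⁻¹ᵁ (sX ''ᵁ V)).ι
  -- the two morphisms `φ₁⁻¹(sX V) → Ub` (second projection; first projection then `η`) agree
  have hab : (φ₁.f ⁻¹ᵁ (sX ''ᵁ V)).ι ≫ φ₂.f =
      (φ₁.f ∣_ (sX ''ᵁ V)) ≫ (sX.isoImage V).inv ≫ η ≫ sU := by
    -- the dominant `K`-point
    let γ : Spec (.of K) ⟶ ((φ₁.f ⁻¹ᵁ (sX ''ᵁ V) : N.X.Opens) : Scheme.{u}) := N.genLift hWn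
    have hγ : γ ≫ (φ₁.f ⁻¹ᵁ (sX ''ᵁ V)).ι = N.gen := N.genLift_ι hWn
    haveI : IsDominant γ := by
      have hpt : (φ₁.f ⁻¹ᵁ (sX ''ᵁ V)).ι (γ (closedPoint K)) =
          (φ₁.f ⁻¹ᵁ (sX ''ᵁ V)).ι
            (genericPoint ((φ₁.f ⁻¹ᵁ (sX ''ᵁ V) : N.X.Opens) : Scheme.{u})) := by
        rw [← Scheme.Hom.comp_apply, hγ, genericPoint_eq_of_isOpenImmersion]
        exact N.genericPt_eq
      have hpt' : γ (closedPoint K) =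
          genericPoint ((φ₁.f ⁻¹ᵁ (sX ''ᵁ V) : N.X.Opens) : Scheme.{u}) :=
        (φ₁.f ⁻¹ᵁ (sX ''ᵁ V)).ι.isOpenEmbedding.injective hpt
      refine ⟨dense_iff_closure_eq.mpr (Set.eq_univ_of_univ_subset ?_)⟩
      have hcl := (genericPoint_spec ((φ₁.f ⁻¹ᵁ (sX ''ᵁ V) : N.X.Opens) : Scheme.{u})).def
      rw [← hpt'] at hcl
      calc (Set.univ : Set ((φ₁.f ⁻¹ᵁ (sX ''ᵁ V) : N.X.Opens) : Scheme.{u}))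
          = closure {γ (closedPoint K)} := hcl.symm
        _ ⊆ closure (Set.range γ) := closure_mono (Set.singleton_subset_iff.mpr ⟨_, rfl⟩)
    refine ext_of_isDominant_of_isSeparated (Y := Ub) πU ?_ γ ?_
    · -- both are morphisms over `k`
      have ha : ((φ₁.f ⁻¹ᵁ (sX ''ᵁ V)).ι ≫ φ₂.f) ≫ πU = (φ₁.f ⁻¹ᵁ (sX ''ᵁ V)).ι ≫ N.π := by
        rw [Category.assoc, φ₂.f_π]
      have e1 : (sX.isoImage V).inv ≫ V.ι ≫ f = (sX ''ᵁ V).ι ≫ πX := by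
        rw [← hsXπ, Scheme.Hom.isoImage_inv_ι_assoc]
      have hb : ((φ₁.f ∣_ (sX ''ᵁ V)) ≫ (sX.isoImage V).inv ≫ η ≫ sU) ≫ πU =
          (φ₁.f ⁻¹ᵁ (sX ''ᵁ V)).ι ≫ N.π := by
        rw [Category.assoc, Category.assoc, Category.assoc, hsUπ, hcomm, e1, ← Category.assoc,
          morphismRestrict_ι, Category.assoc, φ₁.f_π]
      rw [ha, hb]
    · -- both restrict to the `K`-point of `PU`
      have ha : γ ≫ (φ₁.f ⁻¹ᵁ (sX ''ᵁ V)).ι ≫ φ₂.f =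
          Spec.map (CommRingCat.ofHom (algebraMap A K)) ≫ jU ≫ sU := by
        rw [← Category.assoc, hγ, φ₂.gen_f]
      have h3 : (γ ≫ (φ₁.f ∣_ (sX ''ᵁ V))) ≫ (sX ''ᵁ V).ι =
          (Spec.map (CommRingCat.ofHom (algebraMap A K)) ≫ jV ≫ (sX.isoImage V).hom) ≫
            (sX ''ᵁ V).ι := by
        rw [Category.assoc, morphismRestrict_ι, ← Category.assoc, hγ, φ₁.gen_f,
          Category.assoc, Category.assoc, Scheme.Hom.isoImage_hom_ι, ← Category.assoc jV, ← hjXdef]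
      have h3' : γ ≫ (φ₁.f ∣_ (sX ''ᵁ V)) =
          Spec.map (CommRingCat.ofHom (algebraMap A K)) ≫ jV ≫ (sX.isoImage V).hom :=
        (cancel_mono (sX ''ᵁ V).ι).mp h3
      have hb : γ ≫ (φ₁.f ∣_ (sX ''ᵁ V)) ≫ (sX.isoImage V).inv ≫ η ≫ sU =
          Spec.map (CommRingCat.ofHom (algebraMap A K)) ≫ jU ≫ sU := by
        rw [← Category.assoc, h3', Category.assoc, Category.assoc, Iso.hom_inv_id_assoc,
          ← Category.assoc jV, hjVη]
      rw [ha, hb]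
  -- consequence at points: the second projection maps points over `V` into `sU(U)`
  have hover : ∀ (n : N.X) (x : X), x ∈ V → φ₁.f n = sX x → ∃ u : U, φ₂.f n = sU u := by
    intro n x hxV hn
    have hnO : n ∈ (φ₁.f ⁻¹ᵁ (sX ''ᵁ V) : N.X.Opens) := by
      change φ₁.f n ∈ (sX ''ᵁ V : Xb.Opens)
      rw [hn]
      exact ⟨x, hxV, rfl⟩
    refine ⟨η ((sX.isoImage V).inv ((φ₁.f ∣_ (sX ''ᵁ V)) ⟨n, hnO⟩)), ?_⟩
    have := congrArg
      (fun φ : ((φ₁.f ⁻¹ᵁ (sX ''ᵁ V) : N.X.Opens) : Scheme.{u}) ⟶ Ub => φ ⟨n, hnO⟩) hab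
    simp only [Scheme.Hom.comp_apply] at this
    exact this
  /- Step 5: the resolution of `X`: the first projection restricted over `X ≅ sX(X)`. -/
  let ρ : ((φ₁.f ⁻¹ᵁ sX.opensRange : N.X.Opens) : Scheme.{u}) ⟶ X :=
    (φ₁.f ∣_ sX.opensRange) ≫ sX.isoOpensRange.inv
  refine ⟨_, ρ, ⟨inferInstance, (φ₁.isBirational.morphismRestrict sX.opensRange).comp_iso _, ?_⟩⟩
  intro y
  rw [SandwichedGluing.mem_regularLocus_opens_iff]
  obtain ⟨x, hx⟩ : ∃ x : X, sX x = φ₁.f y.1 := y.2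
  by_cases hxV : x ∈ V
  · -- over `V`: regular because `PU` is regular on `U`
    obtain ⟨u, hu⟩ := hover y.1 x hxV hx.symm
    refine h₂ y.1 ?_
    change IsRegularLocalRing (Ub.presheaf.stalk (φ₂.f y.1))
    rw [hu]
    haveI := hUreg u
    exact IsRegularLocalRing.of_ringEquiv (asIso (sU.stalkMap u)).commRingCatIsoToRingEquiv.symm
  · -- off `V`: regular because `X` is regular there
    refine h₁ y.1 ?_
    change IsRegularLocalRing (Xb.presheaf.stalk (φ₁.f y.1))
    rw [← hx]
    haveI := hreg x hxV
    exact IsRegularLocalRing.of_ringEquiv (asIso (sX.stalkMap x)).commRingCatIsoToRingEquiv.symm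

end Costume

/-! ## Model level: local RegLe-ification ⇔ RegLe-ification ⇔ two-model patching -/

namespace ProperModel

/-- **`TwoModelPatching p → RegLeification p`** (patch `M` with `Y`; the second projection
`N → Y` IS `ψ ≫ φ` by uniqueness of domination, `ProperModel.Hom.f_eq`); with
`SandwichedGluing.twoModelPatching_of_regLeification` the two statements are equivalent.
[cite: Piltant2013, Prop. 5.1 (shape)] -/
theorem regLeification_of_twoModelPatching {p : ℕ} (h : TwoModelPatching.{u} p) :
    RegLeification.{u} p := by
  intro k _ _ K _ _ _ M Y φ
  obtain ⟨N, φ₁, φ₂, h₁, h₂⟩ := h k K M Y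
  refine ⟨N, φ₁, h₁, fun y hy => h₂ y ?_⟩
  have e : φ₂.f = (φ₁.comp φ).f := ProperModel.Hom.f_eq _ _
  rwa [e]

/-- **`RegLeification p → LocalRegLeification p`** (take `O = M`, `N = M'`): the local form is
formally the weaker one. [folklore] -/
theorem localRegLeification_of_regLeification {p : ℕ} (h : RegLeification.{u} p) :
    LocalRegLeification.{u} p := by
  intro k _ _ K _ _ _ M Y φ
  obtain ⟨M', ψ, hψ, hψφ⟩ := h k K M Y φ
  let e : M.X ⟶ ((⊤ : M.X.Opens) : Scheme.{u}) := (Scheme.topIso M.X).inv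
  have hval : ∀ x, ((ψ.f ≫ e) x).1 = ψ.f x := fun x => by
    have h1 : ((ψ.f ≫ e) ≫ (⊤ : M.X.Opens).ι) x = ψ.f x := by
      rw [Category.assoc]
      change (ψ.f ≫ (Scheme.topIso M.X).inv ≫ (Scheme.topIso M.X).hom) x = _
      rw [Iso.inv_hom_id, Category.comp_id]
    simpa [Scheme.Hom.comp_apply] using h1
  refine ⟨⊤, M'.X, ψ.f ≫ e, inferInstance, inferInstance, ψ.isBirational.comp_iso e,
    fun _ _ => trivial, fun _ _ => trivial, fun n hn => hψ n ?_, fun n hn => hψφ n ?_⟩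
  · rwa [hval n] at hn
  · rw [hval n] at hn
    rwa [ProperModel.Hom.comp_f, Scheme.Hom.comp_apply]

/-- **Modulo Nagata compactification, `LocalRegLeification p ↔ TwoModelPatching p`**
(`→`: the landed chain `SandwichedGluing.extension_of_nagata`, `regLeification_of_local`,
`SandwichedGluing.twoModelPatching_of_regLeification`; `←`: the two lemmas above).
[cite: Piltant2013, Prop. 5.1 (proof, Steps 2 and 5)] -/
theorem localRegLeification_iff_twoModelPatching {p : ℕ} (hN : NagataCompactification.{u}) :
    LocalRegLeification.{u} p ↔ TwoModelPatching.{u} p :=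
  ⟨fun h => SandwichedGluing.twoModelPatching_of_regLeification p
      (regLeification_of_local p (SandwichedGluing.extension_of_nagata hN) h),
    fun h => localRegLeification_of_regLeification (regLeification_of_twoModelPatching h)⟩

end ProperModel

/-! ## The weak atom implies local RegLe-ification (the reshaped line's stub S3′) -/

/-- An isomorphism is birational. [folklore] -/
theorem isBirational_of_isIso {X Y : Scheme.{u}} (e : X ⟶ Y) [IsIso e] : IsBirational e :=
  ⟨⊤, by simp, by simp, inferInstance⟩

set_option maxHeartbeats 800000 in
/-- **`SandwichedWeakResolution p → ProperModel.LocalRegLeification p`** (the reshaped line's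
stub S3′, as announced by its gen-1 lead): apply the weak atom to the open
`O := Reg M ∪ φ⁻¹(Reg Y)` of `M` — a sandwiched-singularity variety, regular outside
`φ⁻¹(Reg Y)`, which is proper and birational over the regular `Reg Y` (the regular loci are open:
`isOpen_regularLocus_of_locallyOfFiniteType_field`); a weak resolution of `O` is regular
everywhere, so both `RegLe` clauses of `LocalRegLeification` hold. No gluing.
[cite: Piltant2013, Prop. 5.1 (proof, Steps 3-4, replaced by the weak atom)] -/
theorem ProperModel.localRegLeification_of_sandwichedWeakResolution {p : ℕ}
    (hS : SandwichedWeakResolution.{u} p) : ProperModel.LocalRegLeification.{u} p := by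
  intro k _ _ K _ _ _ M Y φ
  -- the regular loci, as opens
  let RM : M.X.Opens := ⟨Scheme.regularLocus M.X, isOpen_regularLocus_of_locallyOfFiniteType_field M.π⟩
  let RY : Y.X.Opens := ⟨Scheme.regularLocus Y.X, isOpen_regularLocus_of_locallyOfFiniteType_field Y.π⟩
  let W' : M.X.Opens := φ.f ⁻¹ᵁ RY
  let O : M.X.Opens := RM ⊔ W'
  have hW'O : W' ≤ O := le_sup_right
  -- `O` and `Reg Y` are integral (non-empty: generic stalks are fields)
  have hgenM : genericPoint M.X ∈ O := by
    refine Or.inl ?_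
    change IsRegularLocalRing M.X.functionField
    infer_instance
  have hgenY : genericPoint Y.X ∈ RY := by
    change IsRegularLocalRing Y.X.functionField
    infer_instance
  haveI : Nonempty (O : Scheme.{u}) := ⟨⟨_, hgenM⟩⟩
  haveI : Nonempty (RY : Scheme.{u}) := ⟨⟨_, hgenY⟩⟩
  haveI : IsIntegral (O : Scheme.{u}) := isIntegral_of_isOpenImmersion O.ι
  haveI : IsIntegral (RY : Scheme.{u}) := isIntegral_of_isOpenImmersion RY.ι
  have hRYreg : Scheme.IsRegular (RY : Scheme.{u}) := by
    intro y
    rw [SandwichedGluing.mem_regularLocus_opens_iff]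
    exact y.2
  -- the sandwiched piece `V = O ∩ φ⁻¹(Reg Y) ≅ φ⁻¹(Reg Y) → Reg Y`
  let V : (O : Scheme.{u}).Opens := O.ι ⁻¹ᵁ W'
  have hrange : Set.range (V.ι ≫ O.ι) = Set.range W'.ι := by
    rw [Scheme.Hom.comp_base, TopCat.coe_comp, Set.range_comp, Scheme.Opens.range_ι,
      Scheme.Opens.range_ι]
    ext m
    constructor
    · rintro ⟨x, hx, rfl⟩
      exact hx
    · intro hm
      exact ⟨⟨m, hW'O hm⟩, hm, rfl⟩
  let e : (V : Scheme.{u}) ≅ (W' : Scheme.{u}) :=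
    IsOpenImmersion.isoOfRangeEq (V.ι ≫ O.ι) W'.ι hrange
  have he : e.hom ≫ W'.ι = V.ι ≫ O.ι := IsOpenImmersion.isoOfRangeEq_hom_fac _ _ _
  let η : (V : Scheme.{u}) ⟶ (RY : Scheme.{u}) := e.hom ≫ (φ.f ∣_ RY)
  have hηbir : IsBirational η := (isBirational_of_isIso e.hom).comp (φ.isBirational.morphismRestrict RY)
  have hcomm : η ≫ (RY.ι ≫ Y.π) = V.ι ≫ (O.ι ≫ M.π) := by
    change (e.hom ≫ (φ.f ∣_ RY)) ≫ RY.ι ≫ Y.π = _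
    rw [Category.assoc, ← Category.assoc (φ.f ∣_ RY), morphismRestrict_ι, Category.assoc, φ.f_π,
      ← Category.assoc, he, Category.assoc]
  have hreg : ∀ x : (O : Scheme.{u}), x ∉ V → IsRegularLocalRing ((O : Scheme.{u}).presheaf.stalk x) := by
    intro x hx
    rw [SandwichedGluing.mem_regularLocus_opens_iff]
    rcases x.2 with h | h
    · exact h
    · exact absurd h hx
  -- apply the weak atom to `O`
  obtain ⟨N, π, hπ⟩ := hS k (O : Scheme.{u}) (RY : Scheme.{u}) (O.ι ≫ M.π) (RY.ι ≫ Y.π) V η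
    inferInstance inferInstance inferInstance inferInstance inferInstance inferInstance
    inferInstance inferInstance hRYreg inferInstance hηbir hcomm hreg
  haveI := hπ.isProper
  haveI : IsReduced N := hπ.isRegular.isReduced
  haveI : IsIntegral N := hπ.isBirational.isIntegral
  refine ⟨O, N, π, inferInstance, inferInstance, hπ.isBirational, fun m hm => Or.inl hm,
    fun m hm => Or.inr hm, fun n _ => hπ.isRegular n, fun n _ => hπ.isRegular n⟩


/-! ## The weak atom is two-model patching -/

/-- **`SandwichedWeakResolution p ↔ ProperModel.TwoModelPatching p`, modulo Nagata
compactification**: the weak atom of line `sandwiched-gluing` IS Piltant's two-model patching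
problem for proper models (open in dimension `≥ 4`, Piltant 2013 p. 2) in geometric dress
(`→`: `ProperModel.localRegLeification_of_sandwichedWeakResolution` and
`ProperModel.localRegLeification_iff_twoModelPatching`; `←`:
`sandwichedWeakResolution_of_twoModelPatching`). [cite: Piltant2013, p. 2 and Prop. 5.1] -/
theorem sandwichedWeakResolution_iff_twoModelPatching {p : ℕ} (hN : NagataCompactification.{u}) :
    SandwichedWeakResolution.{u} p ↔ ProperModel.TwoModelPatching.{u} p :=
  ⟨fun h => (ProperModel.localRegLeification_iff_twoModelPatching hN).mp
      (ProperModel.localRegLeification_of_sandwichedWeakResolution h),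
    fun h => sandwichedWeakResolution_of_twoModelPatching hN h⟩

/-- **The strong atom implies the weak one** (modulo Nagata and two-piece open gluing):
`SandwichedStrongResolution p → SandwichedWeakResolution p`, through the landed gluing
`SandwichedGluing.localRegLeification_of_openGluing_of_sandwiched`,
`ProperModel.localRegLeification_iff_twoModelPatching` and
`sandwichedWeakResolution_of_twoModelPatching`. [folklore] -/
theorem sandwichedWeakResolution_of_sandwichedStrongResolution {p : ℕ}
    (hN : NagataCompactification.{u}) (hOG : OpenGluing.{u})
    (hS : SandwichedStrongResolution.{u} p) : SandwichedWeakResolution.{u} p :=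
  sandwichedWeakResolution_of_twoModelPatching hN
    ((ProperModel.localRegLeification_iff_twoModelPatching hN).mp
      (SandwichedGluing.localRegLeification_of_openGluing_of_sandwiched p hOG hS))

end Literature.AlgebraicGeometry.Resolution

end
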